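import Mathlib
import Summits.NavierStokesRegularity.NavierStokesRegularity.Theorems.FilamentSkeletonRssClause13ModelPieceBandPrelim

/-!
# Clause 13-J/13-R, brick n3 LAYER C (ONE-SIDED BAND PIECE): for `P = a∗Y + i·(b∗Y)` whose profile `χ_a + iχ_b` lives in the band
# `𝔖′(z√q) ≥ σ₀`:  `G(σ₀/√q)‖P‖₂² ≤ (K‖𝓛Y‖₂ + C·‖Y‖₂)·√2(K‖(τ−c)Y‖₂ + K₁‖Y‖₂)`

Route `FilamentSkeletonRss`, ∃-side clause 13 (`Clause13RNearStraightL` stmt-NavierStokesRegularity-23612; typing-agnostic); design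
`filament-plan/DESIGN-28296-model-gluing-g16-v2-addendum.md` §A/§C (BAND piece; task C4).  The band estimate `model_band_estimate` (p694551)
gains from `𝔖′(z√q) ≥ σ₀` on the spectrum; `𝔖′` is odd, so a band piece must be spectrally ONE-SIDED and its kernel is complex, `a + ib` with
`a, b` real (`a` ↔ the even part of the profile, `ib` ↔ the odd part).  `model_piece_band_estimate` feeds `P = a∗Y + i(b∗Y)` to `model_band_estimate`
and bounds the three resulting norms by the real-kernel piece lemmas (p699582, p700907, p701338, prelim file): `‖𝓛P‖₂ ≤ ‖𝓛(a∗Y)‖₂ + ‖𝓛⁻(b∗Y)‖₂`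
(`𝓛(iB) = i𝓛⁻B`, `𝓛⁻` = `𝓛` with `β₂ ↦ −β₂`, and `‖𝓛⁻Y‖₂ ≤ ‖𝓛Y‖₂ + 2b₂‖Y‖₂`), `‖P‖₂ ≤ K‖Y‖₂`, `‖(τ−c)P‖₂ ≤ √2(K‖(τ−c)Y‖₂ + K₁‖Y‖₂)` with
`K = ‖a‖₁+‖b‖₁`, `K₁ = ‖t a‖₁+‖t b‖₁`, `K′₁ = ‖t a′‖₁+‖t b′‖₁`.  The negative band (`𝔖′ ≤ −σ₀`) is reached from this by the reflection
`τ ↦ 2c − τ` (separate file).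
Lane ns-filament-19175-p1 g16; `--supports stmt-NavierStokesRegularity-23612 --as helper`.
HONEST FRAMING: bookkeeping about an explicit 1-D model operator attached to a HYPOTHETICAL filament skeleton on the NEGATIVE side of a MODEL route;
nothing here bears on Navier–Stokes regularity or blow-up.
-/

noncomputable section

open MeasureTheory Real Complex Filter Set
open scoped ComplexConjugate Topology
open Summit.NavierStokesRegularity.NavierStokesRegularity.Theorems.AnalyticStripLiaSymbol (liaSym)

namespace Summit.NavierStokesRegularity.NavierStokesRegularity.Theorems.MatchedKernel
set_option linter.dupNamespace false

/-- **ONE-SIDED BAND PIECE ESTIMATE.**  `q, G > 0`, `σ₀ : ℝ`; `a, b` real `C¹`, bounded, with `a, a′, b, b′` and their `t`-moments in `L¹`,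
profiles `χ_a(z) = ∫a e^{izt}`, `χ_b(z) = ∫b e^{izt}` with `χ_a + iχ_b` supported in the band `σ₀ ≤ 𝔖′(z√q)`; `Y ∈ C¹_c`; `w` differentiable,
`w(c) = 0`, `|w′| ≤ Λ`; `β_i` continuous, `‖β_i‖ ≤ b_i`, `‖β_i(y)−β_i(x)‖ ≤ L_i|y−x|`.  With `P = a∗Y + i(b∗Y)`, `K = ‖a‖₁+‖b‖₁`,
`K₁ = ‖t a‖₁+‖t b‖₁`, `K′₁ = ‖t a′‖₁+‖t b′‖₁`, `N(f) = (∫‖f‖²)^{1/2}`: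
`G(σ₀/√q)∫‖P‖² ≤ (K·N(𝓛Y) + (Λ(K′₁+K) + (L₁+L₂)K₁ + (Λ+b₁+3b₂)K)·N(Y)) · √2(K·N((τ−c)Y) + K₁·N(Y))`. [folklore] -/
theorem model_piece_band_estimate {q G σ₀ : ℝ} (hq : 0 < q) (hG : 0 < G)
    {a a' b b' : ℝ → ℝ} (ha : ∀ t, HasDerivAt a (a' t) t) (ha'c : Continuous a') (hai : Integrable a) (ha'i : Integrable a')
    (ha1 : Integrable fun t => t * a t) (ha'1 : Integrable fun t => t * a' t) {Ma : ℝ} (haM : ∀ t, |a t| ≤ Ma)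
    (hb : ∀ t, HasDerivAt b (b' t) t) (hb'c : Continuous b') (hbi : Integrable b) (hb'i : Integrable b')
    (hb1 : Integrable fun t => t * b t) (hb'1 : Integrable fun t => t * b' t) {Mb : ℝ} (hbM : ∀ t, |b t| ≤ Mb)
    {χa χb : ℝ → ℂ} (haχ : ∀ z : ℝ, ∫ t : ℝ, ((a t : ℝ) : ℂ) * cexp (I * z * t) = χa z)
    (hbχ : ∀ z : ℝ, ∫ t : ℝ, ((b t : ℝ) : ℂ) * cexp (I * z * t) = χb z)
    (hband : ∀ z : ℝ, χa z + I * χb z ≠ 0 → σ₀ ≤ deriv liaSym (z * √q))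
    {Y : ℝ → ℂ} (hY : ContDiff ℝ 1 Y) (hYs : HasCompactSupport Y) (c : ℝ)
    {w : ℝ → ℝ} (hw : Differentiable ℝ w) {Λ : ℝ} (hΛ : ∀ t, |deriv w t| ≤ Λ) (hwc : w c = 0)
    {β₁ β₂ : ℝ → ℂ} (hβ₁c : Continuous β₁) (hβ₂c : Continuous β₂) {b₁ b₂ L₁ L₂ : ℝ}
    (hb₁ : ∀ τ, ‖β₁ τ‖ ≤ b₁) (hb₂ : ∀ τ, ‖β₂ τ‖ ≤ b₂) (hL₁ : ∀ x y, ‖β₁ y - β₁ x‖ ≤ L₁ * |y - x|)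
    (hL₂ : ∀ x y, ‖β₂ y - β₂ x‖ ≤ L₂ * |y - x|) :
    G * (σ₀ / √q) * ∫ x : ℝ, ‖((∫ y : ℝ, ((a (x - y) : ℝ) : ℂ) * Y y) + I * ∫ y : ℝ, ((b (x - y) : ℝ) : ℂ) * Y y)‖ ^ 2
      ≤ (((∫ t, |a t|) + (∫ t, |b t|)) * (∫ y : ℝ, ‖I * (G : ℂ) * ((2 / q : ℂ) * Y y
              - ∫ σ : ℝ, ((((2 * q - (y - σ) ^ 2) * (((y - σ) ^ 2 + q) ^ (5 / 2 : ℝ))⁻¹ : ℝ)) : ℂ) * Y σ)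
            - ((w y : ℝ) : ℂ) * deriv Y y + β₁ y * Y y + β₂ y * conj (Y y)‖ ^ 2) ^ (1 / 2 : ℝ)
          + (Λ * (((∫ t, |t| * |a' t|) + (∫ t, |t| * |b' t|)) + ((∫ t, |a t|) + (∫ t, |b t|))) + (L₁ + L₂) * ((∫ t, |t| * |a t|) + (∫ t, |t| * |b t|))
              + (Λ + b₁ + 3 * b₂) * ((∫ t, |a t|) + (∫ t, |b t|))) * (∫ y : ℝ, ‖Y y‖ ^ 2) ^ (1 / 2 : ℝ))
        * (Real.sqrt 2 * (((∫ t, |a t|) + (∫ t, |b t|)) * (∫ y : ℝ, ‖(((y - c : ℝ) : ℂ)) * Y y‖ ^ 2) ^ (1 / 2 : ℝ)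
          + ((∫ t, |t| * |a t|) + (∫ t, |t| * |b t|)) * (∫ y : ℝ, ‖Y y‖ ^ 2) ^ (1 / 2 : ℝ))) := by
  have hac : Continuous a := continuous_iff_continuousAt.2 fun t => (ha t).continuousAt
  have hbc : Continuous b := continuous_iff_continuousAt.2 fun t => (hb t).continuousAt
  have hYc := hY.continuous
  have hY'c : Continuous (deriv Y) := hY.continuous_deriv le_rfl
  have hΛ0 : 0 ≤ Λ := (abs_nonneg _).trans (hΛ 0)
  have hb10 : 0 ≤ b₁ := (norm_nonneg _).trans (hb₁ 0)
  have hb20 : 0 ≤ b₂ := (norm_nonneg _).trans (hb₂ 0)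
  -- Layer B facts for the two real pieces
  have hA1 : Integrable fun x : ℝ => ∫ y : ℝ, ((a (x - y) : ℝ) : ℂ) * Y y := integrable_piece hai hYc hYs
  have hB1 : Integrable fun x : ℝ => ∫ y : ℝ, ((b (x - y) : ℝ) : ℂ) * Y y := integrable_piece hbi hYc hYs
  have hA2 : MemLp (fun x : ℝ => ∫ y : ℝ, ((a (x - y) : ℝ) : ℂ) * Y y) 2 volume := memLp_piece hac hai hYc hYs
  have hB2 : MemLp (fun x : ℝ => ∫ y : ℝ, ((b (x - y) : ℝ) : ℂ) * Y y) 2 volume := memLp_piece hbc hbi hYc hYs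
  have hA'c : Continuous fun x : ℝ => ∫ y : ℝ, ((a (x - y) : ℝ) : ℂ) * deriv Y y := continuous_piece hac hY'c hYs.deriv
  have hB'c : Continuous fun x : ℝ => ∫ y : ℝ, ((b (x - y) : ℝ) : ℂ) * deriv Y y := continuous_piece hbc hY'c hYs.deriv
  have hAd : ∀ x : ℝ, HasDerivAt (fun x : ℝ => ∫ y : ℝ, ((a (x - y) : ℝ) : ℂ) * Y y) (∫ y : ℝ, ((a (x - y) : ℝ) : ℂ) * deriv Y y) x := hasDerivAt_piece hac hY hYs
  have hBd : ∀ x : ℝ, HasDerivAt (fun x : ℝ => ∫ y : ℝ, ((b (x - y) : ℝ) : ℂ) * Y y) (∫ y : ℝ, ((b (x - y) : ℝ) : ℂ) * deriv Y y) x := hasDerivAt_piece hbc hY hYs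
  have hxA := integrable_smul_piece hac hai ha1 hYc hYs
  have hxB := integrable_smul_piece hbc hbi hb1 hYc hYs
  have hwA2 := memLp_weight_piece hac hai ha1 hYc hYs c
  have hwB2 := memLp_weight_piece hbc hbi hb1 hYc hYs c
  obtain ⟨hwA'2, _⟩ := l2_weight_pieceDeriv_le ha ha'c ha'i ha'1 hY hYs c
  obtain ⟨hwB'2, _⟩ := l2_weight_pieceDeriv_le hb hb'c hb'i hb'1 hY hYs c
  have hMA := memLp_modelSelf_piece hq hac hai haM hYc hYs
  have hMB := memLp_modelSelf_piece hq hbc hbi hbM hYc hYs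
  -- the complex piece `P = A + iB`: hypotheses of `model_band_estimate`
  have hPd : ∀ τ : ℝ, HasDerivAt (fun x : ℝ => ((∫ y : ℝ, ((a (x - y) : ℝ) : ℂ) * Y y) + I * ∫ y : ℝ, ((b (x - y) : ℝ) : ℂ) * Y y))
      (((∫ y : ℝ, ((a (τ - y) : ℝ) : ℂ) * deriv Y y) + I * ∫ y : ℝ, ((b (τ - y) : ℝ) : ℂ) * deriv Y y)) τ := fun τ => (hAd τ).add ((hBd τ).const_mul I)
  have hP'c : Continuous fun τ : ℝ => ((∫ y : ℝ, ((a (τ - y) : ℝ) : ℂ) * deriv Y y) + I * ∫ y : ℝ, ((b (τ - y) : ℝ) : ℂ) * deriv Y y) := hA'c.add (continuous_const.mul hB'c)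
  have hP1 : Integrable fun x : ℝ => ((∫ y : ℝ, ((a (x - y) : ℝ) : ℂ) * Y y) + I * ∫ y : ℝ, ((b (x - y) : ℝ) : ℂ) * Y y) := hA1.add (hB1.const_mul I)
  have hP2 : MemLp (fun x : ℝ => ((∫ y : ℝ, ((a (x - y) : ℝ) : ℂ) * Y y) + I * ∫ y : ℝ, ((b (x - y) : ℝ) : ℂ) * Y y)) 2 volume := hA2.add (hB2.const_mul I)
  have hxP : Integrable fun x : ℝ => x • ((∫ y : ℝ, ((a (x - y) : ℝ) : ℂ) * Y y) + I * ∫ y : ℝ, ((b (x - y) : ℝ) : ℂ) * Y y) := by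
    refine (hxA.add (hxB.const_mul I)).congr (ae_of_all _ fun x => ?_)
    simp only [Pi.add_apply, Complex.real_smul]
    ring
  have hwP2 : MemLp (fun τ : ℝ => ((τ - c : ℝ) : ℂ) * ((∫ y : ℝ, ((a (τ - y) : ℝ) : ℂ) * Y y) + I * ∫ y : ℝ, ((b (τ - y) : ℝ) : ℂ) * Y y)) 2 volume := by
    refine (hwA2.add (hwB2.const_mul I)).ae_eq (ae_of_all _ fun τ => ?_)
    simp only [Pi.add_apply]
    ring
  have hwP'2 : MemLp (fun τ : ℝ => ((τ - c : ℝ) : ℂ) * ((∫ y : ℝ, ((a (τ - y) : ℝ) : ℂ) * deriv Y y) + I * ∫ y : ℝ, ((b (τ - y) : ℝ) : ℂ) * deriv Y y)) 2 volume := by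
    refine (hwA'2.add (hwB'2.const_mul I)).ae_eq (ae_of_all _ fun τ => ?_)
    simp only [Pi.add_apply]
    ring
  -- `K_q∗P = K_q∗A + i K_q∗B`
  have hsplitK : ∀ x : ℝ, ∫ σ : ℝ, ((((2 * q - (x - σ) ^ 2) * (((x - σ) ^ 2 + q) ^ (5 / 2 : ℝ))⁻¹ : ℝ)) : ℂ) * ((∫ y : ℝ, ((a (σ - y) : ℝ) : ℂ) * Y y) + I * ∫ y : ℝ, ((b (σ - y) : ℝ) : ℂ) * Y y)
      = (∫ σ : ℝ, ((((2 * q - (x - σ) ^ 2) * (((x - σ) ^ 2 + q) ^ (5 / 2 : ℝ))⁻¹ : ℝ)) : ℂ) * ∫ y : ℝ, ((a (σ - y) : ℝ) : ℂ) * Y y)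
        + I * ∫ σ : ℝ, ((((2 * q - (x - σ) ^ 2) * (((x - σ) ^ 2 + q) ^ (5 / 2 : ℝ))⁻¹ : ℝ)) : ℂ) * ∫ y : ℝ, ((b (σ - y) : ℝ) : ℂ) * Y y := by
    intro x
    have hIA := integrable_smoothingKernel_mul_of_integrable hq hA1 x
    have hIB := integrable_smoothingKernel_mul_of_integrable hq hB1 x
    have e : (fun σ : ℝ => ((((2 * q - (x - σ) ^ 2) * (((x - σ) ^ 2 + q) ^ (5 / 2 : ℝ))⁻¹ : ℝ)) : ℂ) * ((∫ y : ℝ, ((a (σ - y) : ℝ) : ℂ) * Y y) + I * ∫ y : ℝ, ((b (σ - y) : ℝ) : ℂ) * Y y))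
        = fun σ : ℝ => ((((2 * q - (x - σ) ^ 2) * (((x - σ) ^ 2 + q) ^ (5 / 2 : ℝ))⁻¹ : ℝ)) : ℂ) * (∫ y : ℝ, ((a (σ - y) : ℝ) : ℂ) * Y y)
          + I * (((((2 * q - (x - σ) ^ 2) * (((x - σ) ^ 2 + q) ^ (5 / 2 : ℝ))⁻¹ : ℝ)) : ℂ) * ∫ y : ℝ, ((b (σ - y) : ℝ) : ℂ) * Y y) := by
      funext σ; ring
    rw [e, integral_add hIA (hIB.const_mul I), integral_const_mul]
  have hMP : MemLp (fun τ : ℝ => (2 / q : ℂ) * ((∫ y : ℝ, ((a (τ - y) : ℝ) : ℂ) * Y y) + I * ∫ y : ℝ, ((b (τ - y) : ℝ) : ℂ) * Y y)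
      - ∫ σ : ℝ, ((((2 * q - (τ - σ) ^ 2) * (((τ - σ) ^ 2 + q) ^ (5 / 2 : ℝ))⁻¹ : ℝ)) : ℂ) * ((∫ y : ℝ, ((a (σ - y) : ℝ) : ℂ) * Y y) + I * ∫ y : ℝ, ((b (σ - y) : ℝ) : ℂ) * Y y)) 2 volume := by
    refine (hMA.add (hMB.const_mul I)).ae_eq (ae_of_all _ fun τ => ?_)
    simp only [Pi.add_apply]
    rw [hsplitK τ]
    ring
  -- spectral support of `P`: `P̂ = (χ_a + iχ_b)Ŷ`
  have hsuppP : ∀ z : ℝ, deriv liaSym (z * √q) < σ₀ → ∫ x : ℝ, ((∫ y : ℝ, ((a (x - y) : ℝ) : ℂ) * Y y) + I * ∫ y : ℝ, ((b (x - y) : ℝ) : ℂ) * Y y) * cexp (I * z * x) = 0 := by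
    intro z hz
    have hχ0 : χa z + I * χb z = 0 := by
      by_contra hne
      exact absurd (hband z hne) (not_le.mpr hz)
    rw [transform_twoKernelPiece_eq hai hbi haχ hbχ hYc hYs z, hχ0, zero_mul]
  -- the band estimate for `P`
  have hwin := model_band_estimate hq hG hPd hP'c hP1 hP2 hxP c hwP2 hwP'2 hMP hsuppP hw hΛ hwc
    hβ₁c.aestronglyMeasurable hβ₂c.aestronglyMeasurable hb₁ hb₂
  -- (i) the operator on `P`: `𝓛P = 𝓛A + i𝓛⁻B`
  have hLA := l2_pieceOperator_le (G := G) hq ha ha'c hai ha1 ha'1 haM hY hYs hw hΛ hβ₁c hβ₂c hb₁ hb₂ hL₁ hL₂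
  have hb₂' : ∀ τ, ‖-β₂ τ‖ ≤ b₂ := fun τ => by rw [norm_neg]; exact hb₂ τ
  have hL₂' : ∀ x y, ‖-β₂ y - -β₂ x‖ ≤ L₂ * |y - x| := fun x y => by
    rw [neg_sub_neg, norm_sub_rev]; exact hL₂ x y
  have hLB := l2_pieceOperator_le (G := G) (β₂ := fun y => -β₂ y) hq hb hb'c hbi hb1 hb'1 hbM hY hYs hw hΛ hβ₁c hβ₂c.neg
    hb₁ hb₂' hL₁ hL₂'
  beta_reduce at hLB
  have hLm := l2_modelOperator_negConj_le hq G hY hYs hw.continuous hβ₁c hβ₂c hb₁ hb₂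
  have hLA2 := memLp_modelOperator_piece hq G ha ha'c hai ha'i ha'1 haM hY hYs c hw hΛ hwc hβ₁c hβ₂c hb₁ hb₂
  have hLB2 := memLp_modelOperator_piece hq G (β₂ := fun y => -β₂ y) hb hb'c hbi hb'i hb'1 hbM hY hYs c hw hΛ hwc hβ₁c
    hβ₂c.neg hb₁ hb₂'
  beta_reduce at hLB2
  have hLP : (∫ τ : ℝ, ‖I * (G : ℂ) * ((2 / q : ℂ) * ((∫ y : ℝ, ((a (τ - y) : ℝ) : ℂ) * Y y) + I * ∫ y : ℝ, ((b (τ - y) : ℝ) : ℂ) * Y y)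
          - ∫ σ : ℝ, ((((2 * q - (τ - σ) ^ 2) * (((τ - σ) ^ 2 + q) ^ (5 / 2 : ℝ))⁻¹ : ℝ)) : ℂ) * ((∫ y : ℝ, ((a (σ - y) : ℝ) : ℂ) * Y y) + I * ∫ y : ℝ, ((b (σ - y) : ℝ) : ℂ) * Y y))
        - ((w τ : ℝ) : ℂ) * ((∫ y : ℝ, ((a (τ - y) : ℝ) : ℂ) * deriv Y y) + I * ∫ y : ℝ, ((b (τ - y) : ℝ) : ℂ) * deriv Y y) + β₁ τ * ((∫ y : ℝ, ((a (τ - y) : ℝ) : ℂ) * Y y) + I * ∫ y : ℝ, ((b (τ - y) : ℝ) : ℂ) * Y y) + β₂ τ * conj ((∫ y : ℝ, ((a (τ - y) : ℝ) : ℂ) * Y y) + I * ∫ y : ℝ, ((b (τ - y) : ℝ) : ℂ) * Y y)‖ ^ 2) ^ (1 / 2 : ℝ)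
      ≤ (∫ τ : ℝ, ‖I * (G : ℂ) * ((2 / q : ℂ) * (∫ y : ℝ, ((a (τ - y) : ℝ) : ℂ) * Y y)
          - ∫ σ : ℝ, ((((2 * q - (τ - σ) ^ 2) * (((τ - σ) ^ 2 + q) ^ (5 / 2 : ℝ))⁻¹ : ℝ)) : ℂ) * ∫ y : ℝ, ((a (σ - y) : ℝ) : ℂ) * Y y)
        - ((w τ : ℝ) : ℂ) * (∫ y : ℝ, ((a (τ - y) : ℝ) : ℂ) * deriv Y y) + β₁ τ * (∫ y : ℝ, ((a (τ - y) : ℝ) : ℂ) * Y y) + β₂ τ * conj (∫ y : ℝ, ((a (τ - y) : ℝ) : ℂ) * Y y)‖ ^ 2) ^ (1 / 2 : ℝ)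
        + (∫ τ : ℝ, ‖I * (G : ℂ) * ((2 / q : ℂ) * (∫ y : ℝ, ((b (τ - y) : ℝ) : ℂ) * Y y)
          - ∫ σ : ℝ, ((((2 * q - (τ - σ) ^ 2) * (((τ - σ) ^ 2 + q) ^ (5 / 2 : ℝ))⁻¹ : ℝ)) : ℂ) * ∫ y : ℝ, ((b (σ - y) : ℝ) : ℂ) * Y y)
        - ((w τ : ℝ) : ℂ) * (∫ y : ℝ, ((b (τ - y) : ℝ) : ℂ) * deriv Y y) + β₁ τ * (∫ y : ℝ, ((b (τ - y) : ℝ) : ℂ) * Y y) + -β₂ τ * conj (∫ y : ℝ, ((b (τ - y) : ℝ) : ℂ) * Y y)‖ ^ 2) ^ (1 / 2 : ℝ) := by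
    have e : ∀ τ : ℝ, I * (G : ℂ) * ((2 / q : ℂ) * ((∫ y : ℝ, ((a (τ - y) : ℝ) : ℂ) * Y y) + I * ∫ y : ℝ, ((b (τ - y) : ℝ) : ℂ) * Y y)
          - ∫ σ : ℝ, ((((2 * q - (τ - σ) ^ 2) * (((τ - σ) ^ 2 + q) ^ (5 / 2 : ℝ))⁻¹ : ℝ)) : ℂ) * ((∫ y : ℝ, ((a (σ - y) : ℝ) : ℂ) * Y y) + I * ∫ y : ℝ, ((b (σ - y) : ℝ) : ℂ) * Y y))
        - ((w τ : ℝ) : ℂ) * ((∫ y : ℝ, ((a (τ - y) : ℝ) : ℂ) * deriv Y y) + I * ∫ y : ℝ, ((b (τ - y) : ℝ) : ℂ) * deriv Y y) + β₁ τ * ((∫ y : ℝ, ((a (τ - y) : ℝ) : ℂ) * Y y) + I * ∫ y : ℝ, ((b (τ - y) : ℝ) : ℂ) * Y y) + β₂ τ * conj ((∫ y : ℝ, ((a (τ - y) : ℝ) : ℂ) * Y y) + I * ∫ y : ℝ, ((b (τ - y) : ℝ) : ℂ) * Y y)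
        = (I * (G : ℂ) * ((2 / q : ℂ) * (∫ y : ℝ, ((a (τ - y) : ℝ) : ℂ) * Y y)
          - ∫ σ : ℝ, ((((2 * q - (τ - σ) ^ 2) * (((τ - σ) ^ 2 + q) ^ (5 / 2 : ℝ))⁻¹ : ℝ)) : ℂ) * ∫ y : ℝ, ((a (σ - y) : ℝ) : ℂ) * Y y)
        - ((w τ : ℝ) : ℂ) * (∫ y : ℝ, ((a (τ - y) : ℝ) : ℂ) * deriv Y y) + β₁ τ * (∫ y : ℝ, ((a (τ - y) : ℝ) : ℂ) * Y y) + β₂ τ * conj (∫ y : ℝ, ((a (τ - y) : ℝ) : ℂ) * Y y))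
          + I * (I * (G : ℂ) * ((2 / q : ℂ) * (∫ y : ℝ, ((b (τ - y) : ℝ) : ℂ) * Y y)
          - ∫ σ : ℝ, ((((2 * q - (τ - σ) ^ 2) * (((τ - σ) ^ 2 + q) ^ (5 / 2 : ℝ))⁻¹ : ℝ)) : ℂ) * ∫ y : ℝ, ((b (σ - y) : ℝ) : ℂ) * Y y)
        - ((w τ : ℝ) : ℂ) * (∫ y : ℝ, ((b (τ - y) : ℝ) : ℂ) * deriv Y y) + β₁ τ * (∫ y : ℝ, ((b (τ - y) : ℝ) : ℂ) * Y y) + -β₂ τ * conj (∫ y : ℝ, ((b (τ - y) : ℝ) : ℂ) * Y y)) := by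
      intro τ
      rw [hsplitK τ]
      simp only [map_add, map_mul, Complex.conj_I]
      ring
    simp_rw [e]
    have hI : (∫ τ : ℝ, ‖I * (I * (G : ℂ) * ((2 / q : ℂ) * (∫ y : ℝ, ((b (τ - y) : ℝ) : ℂ) * Y y)
          - ∫ σ : ℝ, ((((2 * q - (τ - σ) ^ 2) * (((τ - σ) ^ 2 + q) ^ (5 / 2 : ℝ))⁻¹ : ℝ)) : ℂ) * ∫ y : ℝ, ((b (σ - y) : ℝ) : ℂ) * Y y)
        - ((w τ : ℝ) : ℂ) * (∫ y : ℝ, ((b (τ - y) : ℝ) : ℂ) * deriv Y y) + β₁ τ * (∫ y : ℝ, ((b (τ - y) : ℝ) : ℂ) * Y y) + -β₂ τ * conj (∫ y : ℝ, ((b (τ - y) : ℝ) : ℂ) * Y y))‖ ^ 2)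
        = ∫ τ : ℝ, ‖I * (G : ℂ) * ((2 / q : ℂ) * (∫ y : ℝ, ((b (τ - y) : ℝ) : ℂ) * Y y)
          - ∫ σ : ℝ, ((((2 * q - (τ - σ) ^ 2) * (((τ - σ) ^ 2 + q) ^ (5 / 2 : ℝ))⁻¹ : ℝ)) : ℂ) * ∫ y : ℝ, ((b (σ - y) : ℝ) : ℂ) * Y y)
        - ((w τ : ℝ) : ℂ) * (∫ y : ℝ, ((b (τ - y) : ℝ) : ℂ) * deriv Y y) + β₁ τ * (∫ y : ℝ, ((b (τ - y) : ℝ) : ℂ) * Y y) + -β₂ τ * conj (∫ y : ℝ, ((b (τ - y) : ℝ) : ℂ) * Y y)‖ ^ 2 := by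
      refine integral_congr_ae (ae_of_all _ fun τ => ?_)
      simp only [norm_mul, Complex.norm_I, one_mul]
    have h := l2_add_le hLA2 (hLB2.const_mul I)
    rw [hI] at h
    exact h
  -- (ii) `N(P) ≤ K·N(Y)`
  obtain ⟨_, hAle⟩ := integral_sq_norm_piece_le hac hai hYc hYs
  obtain ⟨_, hBle⟩ := integral_sq_norm_piece_le hbc hbi hYc hYs
  have hka0 : 0 ≤ ∫ t, |a t| := integral_nonneg fun t => abs_nonneg _
  have hkb0 : 0 ≤ ∫ t, |b t| := integral_nonneg fun t => abs_nonneg _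
  have hka10 : 0 ≤ ∫ t, |t| * |a t| := integral_nonneg fun t => by positivity
  have hkb10 : 0 ≤ ∫ t, |t| * |b t| := integral_nonneg fun t => by positivity
  have hka'10 : 0 ≤ ∫ t, |t| * |a' t| := integral_nonneg fun t => by positivity
  have hkb'10 : 0 ≤ ∫ t, |t| * |b' t| := integral_nonneg fun t => by positivity
  have hNY : 0 ≤ (∫ y : ℝ, ‖Y y‖ ^ 2) ^ (1 / 2 : ℝ) := by positivity
  have hNW : 0 ≤ (∫ y : ℝ, ‖(((y - c : ℝ) : ℂ)) * Y y‖ ^ 2) ^ (1 / 2 : ℝ) := by positivity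
  have hNL : 0 ≤ (∫ y : ℝ, ‖I * (G : ℂ) * ((2 / q : ℂ) * Y y
              - ∫ σ : ℝ, ((((2 * q - (y - σ) ^ 2) * (((y - σ) ^ 2 + q) ^ (5 / 2 : ℝ))⁻¹ : ℝ)) : ℂ) * Y σ)
            - ((w y : ℝ) : ℂ) * deriv Y y + β₁ y * Y y + β₂ y * conj (Y y)‖ ^ 2) ^ (1 / 2 : ℝ) := by positivity
  have hL10 : 0 ≤ L₁ := by
    have := hL₁ 0 1; rw [sub_zero, abs_one, mul_one] at this; exact (norm_nonneg _).trans this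
  have hL20 : 0 ≤ L₂ := by
    have := hL₂ 0 1; rw [sub_zero, abs_one, mul_one] at this; exact (norm_nonneg _).trans this
  have hNA := l2_le_of_sq_le (f := Y) hka0 hAle
  have hNB := l2_le_of_sq_le (f := Y) hkb0 hBle
  have hNP : (∫ x : ℝ, ‖((∫ y : ℝ, ((a (x - y) : ℝ) : ℂ) * Y y) + I * ∫ y : ℝ, ((b (x - y) : ℝ) : ℂ) * Y y)‖ ^ 2) ^ (1 / 2 : ℝ)
      ≤ ((∫ t, |a t|) + (∫ t, |b t|)) * (∫ y : ℝ, ‖Y y‖ ^ 2) ^ (1 / 2 : ℝ) := by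
    have hI : (∫ x : ℝ, ‖I * ∫ y : ℝ, ((b (x - y) : ℝ) : ℂ) * Y y‖ ^ 2) = ∫ x : ℝ, ‖∫ y : ℝ, ((b (x - y) : ℝ) : ℂ) * Y y‖ ^ 2 := by
      refine integral_congr_ae (ae_of_all _ fun x => ?_)
      simp only [norm_mul, Complex.norm_I, one_mul]
    have h := l2_add_le hA2 (hB2.const_mul I)
    rw [hI] at h
    calc _ ≤ _ := h
      _ ≤ (∫ t, |a t|) * (∫ y : ℝ, ‖Y y‖ ^ 2) ^ (1 / 2 : ℝ) + (∫ t, |b t|) * (∫ y : ℝ, ‖Y y‖ ^ 2) ^ (1 / 2 : ℝ) := add_le_add hNA hNB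
      _ = _ := by ring
  -- (iii) `N((τ−c)P) ≤ √2(K·N((τ−c)Y) + K₁·N(Y))`
  have hWA := l2_weight_piece_le hac hai ha1 hYc hYs c
  have hWB := l2_weight_piece_le hbc hbi hb1 hYc hYs c
  have hNWP : (∫ τ : ℝ, ‖((τ - c : ℝ) : ℂ) * ((∫ y : ℝ, ((a (τ - y) : ℝ) : ℂ) * Y y) + I * ∫ y : ℝ, ((b (τ - y) : ℝ) : ℂ) * Y y)‖ ^ 2) ^ (1 / 2 : ℝ)
      ≤ (Real.sqrt 2 * (((∫ t, |a t|) + (∫ t, |b t|)) * (∫ y : ℝ, ‖(((y - c : ℝ) : ℂ)) * Y y‖ ^ 2) ^ (1 / 2 : ℝ)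
          + ((∫ t, |t| * |a t|) + (∫ t, |t| * |b t|)) * (∫ y : ℝ, ‖Y y‖ ^ 2) ^ (1 / 2 : ℝ))) := by
    have e : ∀ τ : ℝ, ((τ - c : ℝ) : ℂ) * ((∫ y : ℝ, ((a (τ - y) : ℝ) : ℂ) * Y y) + I * ∫ y : ℝ, ((b (τ - y) : ℝ) : ℂ) * Y y)
        = ((τ - c : ℝ) : ℂ) * (∫ y : ℝ, ((a (τ - y) : ℝ) : ℂ) * Y y) + I * (((τ - c : ℝ) : ℂ) * ∫ y : ℝ, ((b (τ - y) : ℝ) : ℂ) * Y y) := fun τ => by ring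
    simp_rw [e]
    have hI : (∫ τ : ℝ, ‖I * (((τ - c : ℝ) : ℂ) * ∫ y : ℝ, ((b (τ - y) : ℝ) : ℂ) * Y y)‖ ^ 2)
        = ∫ τ : ℝ, ‖((τ - c : ℝ) : ℂ) * ∫ y : ℝ, ((b (τ - y) : ℝ) : ℂ) * Y y‖ ^ 2 := by
      refine integral_congr_ae (ae_of_all _ fun τ => ?_)
      simp only [norm_mul, Complex.norm_I, one_mul]
    have h := l2_add_le hwA2 (hwB2.const_mul I)
    rw [hI] at h
    calc _ ≤ _ := h
      _ ≤ Real.sqrt 2 * ((∫ t, |a t|) * (∫ y : ℝ, ‖(((y - c : ℝ) : ℂ)) * Y y‖ ^ 2) ^ (1 / 2 : ℝ) + (∫ t, |t| * |a t|) * (∫ y : ℝ, ‖Y y‖ ^ 2) ^ (1 / 2 : ℝ))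
          + Real.sqrt 2 * ((∫ t, |b t|) * (∫ y : ℝ, ‖(((y - c : ℝ) : ℂ)) * Y y‖ ^ 2) ^ (1 / 2 : ℝ) + (∫ t, |t| * |b t|) * (∫ y : ℝ, ‖Y y‖ ^ 2) ^ (1 / 2 : ℝ)) := add_le_add hWA hWB
      _ = _ := by ring
  -- (iv) assemble
  have hfac1 : (∫ τ : ℝ, ‖I * (G : ℂ) * ((2 / q : ℂ) * ((∫ y : ℝ, ((a (τ - y) : ℝ) : ℂ) * Y y) + I * ∫ y : ℝ, ((b (τ - y) : ℝ) : ℂ) * Y y)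
          - ∫ σ : ℝ, ((((2 * q - (τ - σ) ^ 2) * (((τ - σ) ^ 2 + q) ^ (5 / 2 : ℝ))⁻¹ : ℝ)) : ℂ) * ((∫ y : ℝ, ((a (σ - y) : ℝ) : ℂ) * Y y) + I * ∫ y : ℝ, ((b (σ - y) : ℝ) : ℂ) * Y y))
        - ((w τ : ℝ) : ℂ) * ((∫ y : ℝ, ((a (τ - y) : ℝ) : ℂ) * deriv Y y) + I * ∫ y : ℝ, ((b (τ - y) : ℝ) : ℂ) * deriv Y y) + β₁ τ * ((∫ y : ℝ, ((a (τ - y) : ℝ) : ℂ) * Y y) + I * ∫ y : ℝ, ((b (τ - y) : ℝ) : ℂ) * Y y) + β₂ τ * conj ((∫ y : ℝ, ((a (τ - y) : ℝ) : ℂ) * Y y) + I * ∫ y : ℝ, ((b (τ - y) : ℝ) : ℂ) * Y y)‖ ^ 2) ^ (1 / 2 : ℝ)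
        + (Λ + b₁ + b₂) * (∫ x : ℝ, ‖((∫ y : ℝ, ((a (x - y) : ℝ) : ℂ) * Y y) + I * ∫ y : ℝ, ((b (x - y) : ℝ) : ℂ) * Y y)‖ ^ 2) ^ (1 / 2 : ℝ)
      ≤ (((∫ t, |a t|) + (∫ t, |b t|)) * (∫ y : ℝ, ‖I * (G : ℂ) * ((2 / q : ℂ) * Y y
              - ∫ σ : ℝ, ((((2 * q - (y - σ) ^ 2) * (((y - σ) ^ 2 + q) ^ (5 / 2 : ℝ))⁻¹ : ℝ)) : ℂ) * Y σ)
            - ((w y : ℝ) : ℂ) * deriv Y y + β₁ y * Y y + β₂ y * conj (Y y)‖ ^ 2) ^ (1 / 2 : ℝ)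
          + (Λ * (((∫ t, |t| * |a' t|) + (∫ t, |t| * |b' t|)) + ((∫ t, |a t|) + (∫ t, |b t|))) + (L₁ + L₂) * ((∫ t, |t| * |a t|) + (∫ t, |t| * |b t|))
              + (Λ + b₁ + 3 * b₂) * ((∫ t, |a t|) + (∫ t, |b t|))) * (∫ y : ℝ, ‖Y y‖ ^ 2) ^ (1 / 2 : ℝ)) := by
    have h1 := add_le_add hLP (mul_le_mul_of_nonneg_left hNP (by linarith : 0 ≤ Λ + b₁ + b₂))
    refine h1.trans ?_
    have h3 := mul_le_mul_of_nonneg_left hLm hkb0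
    have h4 := mul_nonneg hb20 (mul_nonneg hka0 hNY)
    refine (add_le_add (add_le_add hLA hLB) le_rfl).trans ?_
    -- abbreviate the atoms, then linear arithmetic over monomials
    set nL : ℝ := (∫ y : ℝ, ‖I * (G : ℂ) * ((2 / q : ℂ) * Y y
              - ∫ σ : ℝ, ((((2 * q - (y - σ) ^ 2) * (((y - σ) ^ 2 + q) ^ (5 / 2 : ℝ))⁻¹ : ℝ)) : ℂ) * Y σ)
            - ((w y : ℝ) : ℂ) * deriv Y y + β₁ y * Y y + β₂ y * conj (Y y)‖ ^ 2) ^ (1 / 2 : ℝ) with hnL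
    set nLm : ℝ := (∫ y : ℝ, ‖I * (G : ℂ) * ((2 / q : ℂ) * Y y
              - ∫ σ : ℝ, ((((2 * q - (y - σ) ^ 2) * (((y - σ) ^ 2 + q) ^ (5 / 2 : ℝ))⁻¹ : ℝ)) : ℂ) * Y σ)
            - ((w y : ℝ) : ℂ) * deriv Y y + β₁ y * Y y + -β₂ y * conj (Y y)‖ ^ 2) ^ (1 / 2 : ℝ) with hnLm
    set nY : ℝ := (∫ y : ℝ, ‖Y y‖ ^ 2) ^ (1 / 2 : ℝ) with hnY
    set KA : ℝ := ∫ t, |a t| with hKA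
    set KB : ℝ := ∫ t, |b t| with hKB
    set KA1 : ℝ := ∫ t, |t| * |a t| with hKA1
    set KB1 : ℝ := ∫ t, |t| * |b t| with hKB1
    set KA'1 : ℝ := ∫ t, |t| * |a' t| with hKA'1
    set KB'1 : ℝ := ∫ t, |t| * |b' t| with hKB'1
    linarith [h3, h4]
  have hF1 : 0 ≤ (((∫ t, |a t|) + (∫ t, |b t|)) * (∫ y : ℝ, ‖I * (G : ℂ) * ((2 / q : ℂ) * Y y
              - ∫ σ : ℝ, ((((2 * q - (y - σ) ^ 2) * (((y - σ) ^ 2 + q) ^ (5 / 2 : ℝ))⁻¹ : ℝ)) : ℂ) * Y σ)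
            - ((w y : ℝ) : ℂ) * deriv Y y + β₁ y * Y y + β₂ y * conj (Y y)‖ ^ 2) ^ (1 / 2 : ℝ)
          + (Λ * (((∫ t, |t| * |a' t|) + (∫ t, |t| * |b' t|)) + ((∫ t, |a t|) + (∫ t, |b t|))) + (L₁ + L₂) * ((∫ t, |t| * |a t|) + (∫ t, |t| * |b t|))
              + (Λ + b₁ + 3 * b₂) * ((∫ t, |a t|) + (∫ t, |b t|))) * (∫ y : ℝ, ‖Y y‖ ^ 2) ^ (1 / 2 : ℝ)) := by positivity
  calc G * (σ₀ / √q) * ∫ x : ℝ, ‖((∫ y : ℝ, ((a (x - y) : ℝ) : ℂ) * Y y) + I * ∫ y : ℝ, ((b (x - y) : ℝ) : ℂ) * Y y)‖ ^ 2 ≤ _ := hwin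
    _ ≤ _ := mul_le_mul hfac1 hNWP (by positivity) hF1

end Summit.NavierStokesRegularity.NavierStokesRegularity.Theorems.MatchedKernel

end
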